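import Summits.KontsevichZagierPeriods.KontsevichZagierPeriods.Theorems.ReducedPeriodRing.Negative.OrderTrichotomy

/-!
# `ReducedPeriodRing` (stmt-KontsevichZagierPeriods-3929) — `eval` is the only volume-dominated invariant

Negative knowledge for the crux (the MEASURE / VALUATION lens is closed). A refutation of the crux,
or of Conjecture 1, is an additive map `Λ` on `KZ.FormalRep` killing the four move families and not
vanishing on some square-zero class (`Negative/Certificates.lean`,
`not_reducedPeriodRing_iff_certificate`). This file shows that such a certificate can never be
*dominated by the volume*: if `Λ : FormalRep →+ A` (any real normed space `A`) kills
`KZ.relations` and satisfies `‖Λ [K, 1]‖ ≤ C · vol K` for the compact `ℚ`-semialgebraic bodies `K`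
(integrand `1` on the domain, non-empty interior), then

* `dominated_invariant_eq_zero_of_eval_eq_zero` — `Λ` vanishes on the whole of `ker eval`
  (by lead c8's `exists_body_add_sub_body_mem_relations`: a class of value `0` is, modulo the
  moves, a difference `[E′, 1] − [E, 1]` of two bodies of the SAME, arbitrarily small, rational
  volume `ε`, so `‖Λ c‖ ≤ 2 C ε` for every `ε`);
* `dominated_invariant_apply_of_eval_eq_ratCast`, `dominated_invariant_eq_eval_smul` — hence
  `Λ = eval(·) • Λ u` for any `u` of value `1`: rational values are calibrated through `ker eval`,
  and an irrational value is squeezed between rational ones with an error body of volume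
  `eval c − q` (`exists_body_of_eval_pos`, the Viu-Sos normal form);
  `dominated_invariant_eq_mul_eval` / `dominated_invariant_eq_eval` are the real-valued forms
  `Λ = κ · eval`, `Λ = eval`;
* `dominated_certificate_vanishes`, `l1Dominated_certificate_vanishes` — in particular a
  volume-dominated (a fortiori an `L¹`-dominated, `‖Λ [σ, f]‖ ≤ C ∫_σ |f|`) invariant vanishes on
  every candidate `c` with `c * c ∈ relations`, exactly like the multiplicative and the
  bounded-exponent certificates of `Negative/Certificates.lean`;
* `eval_dominated` — `eval` itself is dominated with constant `1`, so the hypothesis is sharp.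

Consequences recorded for the crux census: integration of the representations against ANY family
of densities `(ρₘ)ₘ` bounded uniformly in the dimension, any finitely additive functional of the
domain/integrand data bounded by a fixed multiple of the volume on bodies, any Banach-limit or
ultrafilter renormalisation so bounded — if move-invariant, all are real multiples of `eval` on
`P = FormalRep ⧸ relations` and detect nothing in `ker eval`. A certificate against the crux is
necessarily UNBOUNDED relative to the volume on bodies (as are the slice functionals of
`Negative/SliceFunctional.lean`, which carry Dirac factors — and indeed do not kill
`KZ.relations`). The same holds for a certificate against Conjecture 1 itself (a move-invariant
additive functional not vanishing on `ker eval`, `Negative/RingForms.lean`). The converse is void: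
undominated invariants exist unconditionally (a discontinuous `ℚ`-linear function of the value),
so domination restricts certificates; it does not reformulate the conjecture.
Lead c9, `--supports stmt-KontsevichZagierPeriods-3929`; no definitions, no named facts.
[Kontsevich–Zagier 2001, §1.2; Viu-Sos, IJNT 17 (2021), Thm. 1.1]
-/

noncomputable section

namespace Summit.KontsevichZagierPeriods.KontsevichZagierPeriods.ReducedPeriodRingNegative

open MeasureTheory Set
open Literature.NumberTheory.Transcendental KZ
open Summit.KontsevichZagierPeriods.KontsevichZagierPeriods.Theses.FurushoPentagon

variable {A : Type*} [NormedAddCommGroup A]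

/-! ### A dominated invariant kills `ker eval` -/

/-- **A volume-dominated move-invariant functional vanishes on `ker eval`.** If `Λ` kills the
relations and `‖Λ [K, 1]‖ ≤ C · vol K` for every compact body `K` with non-empty interior and
integrand `1`, then `Λ c = 0` whenever `eval c = 0`: by `exists_body_add_sub_body_mem_relations`,
`c ∼ [E′, 1] − [E, 1]` with `vol E = vol E′ = ε` for every rational `ε > 0`, whence
`‖Λ c‖ ≤ 2 C ε`. [Viu-Sos, IJNT 17 (2021), Thm. 1.1] -/
theorem dominated_invariant_eq_zero_of_eval_eq_zero {Λ : FormalRep →+ A} {C : ℝ}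
    (hΛ : ∀ c ∈ relations, Λ c = 0)
    (hdom : ∀ (m : ℕ) (K : IntegralRep m), IsCompact K.domain → (interior K.domain).Nonempty →
      (∀ z ∈ K.domain, K.integrand z = 1) → ‖Λ (of K)‖ ≤ C * K.value)
    {c : FormalRep} (hc : eval c = 0) : Λ c = 0 := by
  by_contra hne
  have hδ : 0 < ‖Λ c‖ := norm_pos_iff.mpr hne
  have hC : (0 : ℝ) < 2 * |C| + 1 := by positivity
  obtain ⟨ε, hε0, hε⟩ := exists_rat_btwn (div_pos hδ hC)
  have hε0' : (0 : ℚ) < ε := by exact_mod_cast hε0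
  obtain ⟨m, E, m', E', hEc, hEi, hE1, hE'c, hE'i, hE'1, hEv, hE'v, hrel⟩ :=
    exists_body_add_sub_body_mem_relations hc hε0'
  have h0 : Λ (c + of E - of E') = 0 := hΛ _ hrel
  rw [map_sub, map_add, sub_eq_zero] at h0
  have hcE : Λ c = Λ (of E') - Λ (of E) := eq_sub_of_add_eq h0
  have h1 : ‖Λ c‖ ≤ C * ε + C * ε := by
    rw [hcE]
    refine (norm_sub_le _ _).trans (add_le_add ?_ ?_)
    · simpa only [hE'v] using hdom m' E' hE'c hE'i hE'1
    · simpa only [hEv] using hdom m E hEc hEi hE1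
  have h2 : C * ε ≤ |C| * ε := mul_le_mul_of_nonneg_right (le_abs_self C) hε0.le
  have h3 : (ε : ℝ) * (2 * |C| + 1) < ‖Λ c‖ := (lt_div_iff₀ hC).mp hε
  nlinarith [h1, h2, h3, hε0]

/-- **Volume-dominated certificates vanish on every candidate**: if `c * c ∈ relations` then
`eval c = 0` (`eval` is multiplicative and sound), so every volume-dominated move-invariant
functional kills `c`. Companion of `multiplicative_certificate_vanishes` and
`bounded_exponent_certificate_vanishes` (`Negative/Certificates.lean`). [folklore] -/
theorem dominated_certificate_vanishes {Λ : FormalRep →+ A} {C : ℝ}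
    (hΛ : ∀ c ∈ relations, Λ c = 0)
    (hdom : ∀ (m : ℕ) (K : IntegralRep m), IsCompact K.domain → (interior K.domain).Nonempty →
      (∀ z ∈ K.domain, K.integrand z = 1) → ‖Λ (of K)‖ ≤ C * K.value)
    {c : FormalRep} (hc : c * c ∈ relations) : Λ c = 0 := by
  refine dominated_invariant_eq_zero_of_eval_eq_zero hΛ hdom ?_
  have h0 : eval (c * c) = 0 := relations_le_ker_eval_holds hc
  rw [eval_mul'] at h0
  exact mul_self_eq_zero.mp h0

/-- The value of a body (integrand `1` on its domain) is the integral of `|integrand|` over the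
domain. [folklore] -/
theorem setIntegral_abs_integrand_eq_value {m : ℕ} (K : IntegralRep m)
    (hK1 : ∀ z ∈ K.domain, K.integrand z = 1) :
    ∫ x in K.domain, |K.integrand x| = K.value := by
  rw [IntegralRep.value]
  refine setIntegral_congr_fun (IntegralRep.measurableSet_domain_holds K) fun x hx => ?_
  simp only [hK1 x hx, abs_one]

/-- The value of a body (integrand `1` on its domain) is non-negative. [folklore] -/
theorem value_nonneg_of_integrand_eq_one {m : ℕ} (K : IntegralRep m)
    (hK1 : ∀ z ∈ K.domain, K.integrand z = 1) : 0 ≤ K.value := by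
  rw [IntegralRep.value]
  exact setIntegral_nonneg (IntegralRep.measurableSet_domain_holds K) fun x hx => by
    rw [hK1 x hx]; exact zero_le_one

/-- **`L¹`-dominated certificates vanish on every candidate.** A move-invariant functional with
`‖Λ [σ, f]‖ ≤ C ∫_σ |f|` for all representations (e.g. integration against any family of
densities bounded by `C`) is volume-dominated on bodies, hence kills every `c` with
`c * c ∈ relations`. [folklore] -/
theorem l1Dominated_certificate_vanishes {Λ : FormalRep →+ A} {C : ℝ}
    (hΛ : ∀ c ∈ relations, Λ c = 0)
    (hL1 : ∀ (n : ℕ) (r : IntegralRep n), ‖Λ (of r)‖ ≤ C * ∫ x in r.domain, |r.integrand x|)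
    {c : FormalRep} (hc : c * c ∈ relations) : Λ c = 0 :=
  dominated_certificate_vanishes hΛ
    (fun m K _ _ hK1 => by simpa only [setIntegral_abs_integrand_eq_value K hK1] using hL1 m K) hc

/-- **`eval` is volume-dominated with constant `1`** (so the domination hypothesis is sharp: the
conclusion `Λ = κ · eval` below cannot be improved to `Λ = 0`). [folklore] -/
theorem eval_dominated {m : ℕ} (K : IntegralRep m) (hK1 : ∀ z ∈ K.domain, K.integrand z = 1) :
    ‖eval (of K)‖ ≤ 1 * K.value := by
  rw [eval_of, one_mul, Real.norm_eq_abs, abs_of_nonneg (value_nonneg_of_integrand_eq_one K hK1)]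

/-! ### A dominated invariant is `eval(·) • Λ u` -/

/-- **Rational calibration.** For a volume-dominated move-invariant `Λ`, a class of rational value
`q` takes the value `q • Λ u` for any `u` of value `1`: `den(q) • d − num(q) • u ∈ ker eval` is
killed by `Λ` (`dominated_invariant_eq_zero_of_eval_eq_zero`). [folklore] -/
theorem dominated_invariant_apply_of_eval_eq_ratCast [NormedSpace ℝ A] {Λ : FormalRep →+ A}
    {C : ℝ} (hΛ : ∀ c ∈ relations, Λ c = 0)
    (hdom : ∀ (m : ℕ) (K : IntegralRep m), IsCompact K.domain → (interior K.domain).Nonempty →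
      (∀ z ∈ K.domain, K.integrand z = 1) → ‖Λ (of K)‖ ≤ C * K.value)
    {u : FormalRep} (hu : eval u = 1) {d : FormalRep} {q : ℚ} (hd : eval d = q) :
    Λ d = (q : ℝ) • Λ u := by
  have hqr : (q : ℝ) * (q.den : ℝ) = (q.num : ℝ) := by exact_mod_cast Rat.mul_den_eq_num q
  have hx : eval ((q.den : ℤ) • d - q.num • u) = 0 := by
    rw [map_sub, map_zsmul, map_zsmul, hd, hu, zsmul_eq_mul, zsmul_eq_mul, mul_one, sub_eq_zero,
      mul_comm]
    exact_mod_cast hqr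
  have h0 := dominated_invariant_eq_zero_of_eval_eq_zero hΛ hdom hx
  rw [map_sub, map_zsmul, map_zsmul, sub_eq_zero] at h0
  have h1 : (q.den : ℝ) • Λ d = (q.num : ℝ) • Λ u := by
    have h0' : ((q.den : ℤ) : ℝ) • Λ d = ((q.num : ℤ) : ℝ) • Λ u := by
      rw [Int.cast_smul_eq_zsmul, Int.cast_smul_eq_zsmul]
      exact h0
    simpa only [Int.cast_natCast] using h0'
  have hden : (q.den : ℝ) ≠ 0 := Nat.cast_ne_zero.mpr q.den_nz
  calc Λ d = (q.den : ℝ)⁻¹ • ((q.den : ℝ) • Λ d) := by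
        rw [smul_smul, inv_mul_cancel₀ hden, one_smul]
    _ = (q.den : ℝ)⁻¹ • ((q.num : ℝ) • Λ u) := by rw [h1]
    _ = (q : ℝ) • Λ u := by rw [smul_smul, Rat.cast_def, div_eq_inv_mul]

/-- **`eval` is the only volume-dominated invariant, up to a vector constant.** If
`Λ : FormalRep →+ A` (`A` a real normed space) kills `KZ.relations` and is dominated by the volume
on bodies, then `Λ c = eval c • Λ u` for every `c` and every `u` of value `1`. Proof: squeeze
`eval c` from below by rationals `q`; `c − [pt, q]` has positive value `eval c − q`, so it is a
body of that volume modulo the moves (`exists_body_of_eval_pos`), on which `Λ` is `O(eval c − q)`.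
[Viu-Sos, IJNT 17 (2021), Thm. 1.1] -/
theorem dominated_invariant_eq_eval_smul [NormedSpace ℝ A] {Λ : FormalRep →+ A} {C : ℝ}
    (hΛ : ∀ c ∈ relations, Λ c = 0)
    (hdom : ∀ (m : ℕ) (K : IntegralRep m), IsCompact K.domain → (interior K.domain).Nonempty →
      (∀ z ∈ K.domain, K.integrand z = 1) → ‖Λ (of K)‖ ≤ C * K.value)
    {u : FormalRep} (hu : eval u = 1) (c : FormalRep) : Λ c = eval c • Λ u := by
  by_contra hne
  set t : ℝ := eval c with ht
  have hδ : 0 < ‖Λ c - t • Λ u‖ := norm_pos_iff.mpr (sub_ne_zero.mpr hne)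
  set M : ℝ := |C| + ‖Λ u‖ + 1 with hM
  have hM0 : 0 < M := by positivity
  -- a rational `q` just below `t`
  obtain ⟨q, hq1, hq2⟩ := exists_rat_btwn (sub_lt_self t (div_pos hδ hM0))
  have htq : 0 < t - q := sub_pos.mpr hq2
  -- the constant `[pt, q]` and the error body for `c − [pt, q]`
  obtain ⟨r, hr⟩ := exists_eval_of_eq_ratCast q
  have hpos : 0 < eval (c - of r) := by rw [map_sub, hr, ← ht]; exact htq
  obtain ⟨m, K, hKc, hKi, hK1, hK⟩ := exists_body_of_eval_pos hpos
  have hKv : K.value = t - q := by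
    have h1 : eval (c - of r - of K) = 0 := relations_le_ker_eval_holds hK
    rw [map_sub, sub_eq_zero, map_sub, hr, eval_of, ← ht] at h1
    exact h1.symm
  have hΛK : Λ (c - of r) = Λ (of K) := by
    have h1 : Λ (c - of r - of K) = 0 := hΛ _ hK
    rwa [map_sub, sub_eq_zero] at h1
  have hΛr : Λ (of r) = (q : ℝ) • Λ u := dominated_invariant_apply_of_eval_eq_ratCast hΛ hdom hu hr
  -- `Λ c − t • Λ u = Λ [K] + (q − t) • Λ u`
  have hdecomp : Λ c - t • Λ u = Λ (of K) + ((q : ℝ) - t) • Λ u := by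
    have h1 : Λ c = Λ (c - of r) + Λ (of r) := by rw [map_sub, sub_add_cancel]
    rw [h1, hΛK, hΛr, sub_smul]
    abel
  have hbound : ‖Λ c - t • Λ u‖ ≤ (|C| + ‖Λ u‖) * (t - q) := by
    rw [hdecomp]
    refine (norm_add_le _ _).trans ?_
    have h1 : ‖Λ (of K)‖ ≤ |C| * (t - q) := by
      refine (hdom m K hKc hKi hK1).trans ?_
      rw [hKv]
      exact mul_le_mul_of_nonneg_right (le_abs_self C) htq.le
    have h2 : ‖((q : ℝ) - t) • Λ u‖ = ‖Λ u‖ * (t - q) := by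
      rw [norm_smul, Real.norm_eq_abs, abs_sub_comm, abs_of_pos htq, mul_comm]
    rw [add_mul]
    exact add_le_add h1 h2.le
  have hlt : (|C| + ‖Λ u‖) * (t - q) < ‖Λ c - t • Λ u‖ := by
    have h1 : t - q < ‖Λ c - t • Λ u‖ / M := by linarith
    have h2 : (t - q) * M < ‖Λ c - t • Λ u‖ := (lt_div_iff₀ hM0).mp h1
    have h3 : (|C| + ‖Λ u‖) * (t - q) ≤ (t - q) * M := by
      rw [mul_comm]
      exact mul_le_mul_of_nonneg_left (by rw [hM]; linarith) htq.le
    exact h3.trans_lt h2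
  exact absurd (hbound.trans_lt hlt) (lt_irrefl _)

/-- **Real-valued form: `Λ = κ · eval`.** Every volume-dominated move-invariant additive functional
`FormalRep →+ ℝ` is a real multiple of the evaluation `eval` (with `κ = Λ [pt, 1]`).
[Viu-Sos, IJNT 17 (2021), Thm. 1.1] -/
theorem dominated_invariant_eq_mul_eval {Λ : FormalRep →+ ℝ} {C : ℝ}
    (hΛ : ∀ c ∈ relations, Λ c = 0)
    (hdom : ∀ (m : ℕ) (K : IntegralRep m), IsCompact K.domain → (interior K.domain).Nonempty →
      (∀ z ∈ K.domain, K.integrand z = 1) → |Λ (of K)| ≤ C * K.value) :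
    ∃ κ : ℝ, ∀ c : FormalRep, Λ c = κ * eval c := by
  obtain ⟨u, hu⟩ := exists_eval_of_eq_ratCast 1
  have hu1 : eval (of u) = 1 := by rw [hu, Rat.cast_one]
  refine ⟨Λ (of u), fun c => ?_⟩
  have h := dominated_invariant_eq_eval_smul (A := ℝ) hΛ
    (fun m K hKc hKi hK1 => by rw [Real.norm_eq_abs]; exact hdom m K hKc hKi hK1) hu1 c
  rw [h, smul_eq_mul, mul_comm]

/-- **Uniqueness of the period functional.** A volume-dominated move-invariant additive functional
`FormalRep →+ ℝ` normalised by `Λ u = 1` on one class `u` of value `1` IS the evaluation map.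
[Viu-Sos, IJNT 17 (2021), Thm. 1.1] -/
theorem dominated_invariant_eq_eval {Λ : FormalRep →+ ℝ} {C : ℝ}
    (hΛ : ∀ c ∈ relations, Λ c = 0)
    (hdom : ∀ (m : ℕ) (K : IntegralRep m), IsCompact K.domain → (interior K.domain).Nonempty →
      (∀ z ∈ K.domain, K.integrand z = 1) → |Λ (of K)| ≤ C * K.value)
    {u : FormalRep} (hu : eval u = 1) (hΛu : Λ u = 1) : Λ = eval := by
  refine AddMonoidHom.ext fun c => ?_
  have h := dominated_invariant_eq_eval_smul (A := ℝ) hΛ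
    (fun m K hKc hKi hK1 => by rw [Real.norm_eq_abs]; exact hdom m K hKc hKi hK1) hu c
  rw [h, hΛu, smul_eq_mul, mul_one]

/-- **The crux in the certificate language, sharpened.** `¬ ReducedPeriodRing` iff there is an
additive certificate `φ` killing the relations with `φ c ≠ 0` on a square-zero class — and any such
real-valued `φ` is NOT volume-dominated on bodies: for every constant `C` some compact body `K`
has `|φ [K, 1]| > C · vol K`. [folklore] -/
theorem certificate_not_dominated {φ : FormalRep →+ ℝ} (hφ : ∀ c ∈ relations, φ c = 0)
    {c : FormalRep} (hc : c * c ∈ relations) (hne : φ c ≠ 0) (C : ℝ) :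
    ∃ (m : ℕ) (K : IntegralRep m), IsCompact K.domain ∧ (interior K.domain).Nonempty ∧
      (∀ z ∈ K.domain, K.integrand z = 1) ∧ C * K.value < |φ (of K)| := by
  by_contra h
  push Not at h
  exact hne (dominated_certificate_vanishes (A := ℝ) hφ
    (fun m K hKc hKi hK1 => by rw [Real.norm_eq_abs]; exact h m K hKc hKi hK1) hc)

end Summit.KontsevichZagierPeriods.KontsevichZagierPeriods.ReducedPeriodRingNegative
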